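import Summits.BirchSwinnertonDyer.BirchSwinnertonDyer.Theorems.PrintCf2RamifiedOffTYZLowerHalfTwoPrimesEvenOfDisplays
import Literature.NumberTheory.EllipticCurves.TianYuanZhang2017.CMPointFrobeniusValueDisplays
import HarnessLib

/-!
# Crux `PrintCf2.RamifiedOffTYZOfFacts` (stmt-BirchSwinnertonDyer-20509), line `offtyz-v7`, LEAD cycle 13 (cruxlead-20509 g12):
# THE EVEN TWO-PRIME LOWER HALF FROM THE NAMED FACTS — `tyz_cmPointRingClassFrobeniusValueData ∧ thm11_parity_of_scriptL ∧ GZK` imply: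
# on `n = 2lq` (`l ≡ 1 (8)`, `q ≡ 3 (4)`, `(l/q) = 1`, i.e. the even two-prime jump-one class) with `r_an(E_n) = 1` and a generator `R = (x, y)` of
# `E_n(ℚ)` modulo torsion with `x ∉ {±1, ±2, ±n, ±2n}·ℚ^{×2}`, the Tian–Yuan–Zhang integer `𝓛(n)` is EVEN

THEOREMS ONLY (no `def`, no named fact, no `sorry`), `--supports stmt-BirchSwinnertonDyer-20509` (item 23431 = C⁺, even sectors E1/E2).  The `OfFacts`
packaging of `…LowerHalfTwoPrimesEvenOfDisplays` (p733790) over the typer's value display `CMPointFrobeniusValueDisplays` (ty2, p733876: the Frobenius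
clause (F1)–(F3) of `𝔭_l` WITH (F5) «`φ_l ∉ Gal(ℍ′_n/H_n)`», PROVED there from the value of the conductor-`4` dictionary at `φ_l` and the
non-principality of `𝔭_l`).  The closed shape `two_dvd_scriptL_two_primes_even_of_facts` is the text a planner can file as an aside of item 23431 and
close BY NAME.  HONEST FRAMING: conditional on three named facts without `_holds` in the tree (TYZ §3 as printed with the Frobenius values, TYZ Thm 1.1,
GZK); nothing is asserted; C⁺ stays open; BSD is not proved by any of this; no class is closed by this file.

References: [cite: TianYuanZhang2017, Thm. 1.1, §1 (p0002 L101–L110), §3 (Prop. 3.2 (2), Thm. 3.5, Thm. 3.6 (2), Lemma 3.18, proof of Lemma 3.21)];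
[cite: Cox2013, §5.C Lemma 5.19, (5.22), Thm. 5.23, Cor. 5.25, §9.A]; [cite: HeathBrown1994SelmerCongruentII, §1 and Appendix (Monsky)];
[cite: SilvermanAEC2009, X.4.9]; [cite: Darmon2004, Thm. 3.22].
-/

noncomputable section

open scoped Classical

open WeierstrassCurve WeierstrassCurve.Affine Literature.NumberTheory.EllipticCurves
  Literature.NumberTheory.EllipticCurves.TianYuanZhang2017
  Literature.NumberTheory.EllipticCurves.TianYuanZhang2017.W2
  Summit.BirchSwinnertonDyer.PrintCf2.LowerHalfTwoPrimesEvenDisplays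

set_option autoImplicit false

namespace Summit.BirchSwinnertonDyer.PrintCf2.LowerHalfTwoPrimesEvenFacts

variable {n : ℕ}

/-- **THE LOWER HALF ON THE EVEN TWO-PRIME CLASS over `D.Printed ∧ D.CMPointRingClassFrobeniusFourPrintedH`** (the typer's packaged layer carrying
(F5)): hypotheses = GZK, Thm 1.1 by name, `n = 2lq` square-free with `l ≡ 1 (8)`, `q ≡ 3 (4)`, `(l/q) = 1`, analytic rank one, and a generator
`R = (x, y)` of `E_n(ℚ)` modulo torsion with `x ∉ {±1, ±2, ±n, ±2n}·ℚ^{×2}`; conclusion `2 ∣ L` whenever `𝓛(n)² = L²`.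
[cite: TianYuanZhang2017, Thm. 1.1 and §3 (Prop. 3.2 (2), Thm. 3.5, Thm. 3.6 (2), Lemma 3.18, proof of Lemma 3.21)] [cite: Cox2013, §5.C Cor. 5.25, §9.A] [cite: Darmon2004, Thm. 3.22] -/
theorem two_dvd_scriptL_two_primes_even_of_printedH (hGZK : rank_eq_analyticRank_of_analyticRank_le_one) (h11 : thm11_parity_of_scriptL)
    (hsq : Squarefree n) {l q : ℕ} (hl : l.Prime) (hq : q.Prime) (hlq : l ≠ q) (hn : n = 2 * l * q) (hl8 : l % 8 = 1) (hq4 : q % 4 = 3)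
    (hleg : jacobiSym l q = 1)
    (hr : haveI := isElliptic_congruentNumberCurve hsq.ne_zero; (congruentNumberCurve n).analyticRank = 1)
    (D : GenusPointData n) (hPr : D.Printed) (hH : D.CMPointRingClassFrobeniusFourPrintedH)
    {x y : ℚ} (hxy : (congruentNumberCurve n).toAffine.Nonsingular x y)
    (hgen : haveI := isElliptic_congruentNumberCurve hsq.ne_zero;
      ∀ P, ∃ k : ℤ, IsOfFinAddOrder (P - k • (Point.some x y hxy : (congruentNumberCurve n).toAffine.Point)))
    (hx : ¬ ∃ r : ℚ, x = r ^ 2 ∨ x = -r ^ 2 ∨ x = n * r ^ 2 ∨ x = -(n * r ^ 2))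
    (hx2 : ¬ ∃ r : ℚ, x = 2 * r ^ 2 ∨ x = -(2 * r ^ 2) ∨ x = 2 * n * r ^ 2 ∨ x = -(2 * n * r ^ 2)) :
    ∀ L : ℤ, IsScriptL n L → (2 : ℤ) ∣ L := by
  have hn0 : n ≠ 0 := hsq.ne_zero
  have hnn : n ∈ n.divisors := Nat.mem_divisors_self n hn0
  have h6 : n % 8 = 6 := by
    rw [hn, mul_assoc, Nat.mul_mod, show (l * q) % 8 = q % 8 by rw [Nat.mul_mod, hl8, one_mul, Nat.mod_mod]]; omega
  have hln : l ∣ n := ⟨2 * q, by rw [hn]; ring⟩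
  have hl2 : l ≠ 2 := by omega
  have hlt : l < n := by
    rw [hn]; have := hq.two_le; have := hl.two_le; nlinarith
  obtain ⟨z, Φ, ΓH, ΓH', σ, θ, c, ρ₂, ρ₄, hc, hall⟩ := hH
  have hFrobl : ∃ φ : D.H ≃ₐ[ℚ] D.H, φ (D.sqrtNeg n) = D.sqrtNeg n ∧ φ * φ ∈ ΓH' n ∧ φ D.im = (jacobiSym (-1) l) • D.im ∧
      (∀ r : ℕ, r.Prime → r ∣ n → r ≠ l → φ (D.sqrtNeg r) = (jacobiSym (-(r : ℤ)) l) • D.sqrtNeg r) ∧ φ ∉ ΓH n :=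
    (hall n hnn).2.2.2.2.2.2.2 h6 l hl hln hl2 hlt
  exact two_dvd_scriptL_two_primes_even_of_displays hGZK hsq hl hq hlq hn hl8 hq4 hleg hr D hPr h11 z Φ ΓH ΓH' σ c hc
    (fun d hd => ⟨(hall d hd).1, (hall d hd).2.2.1⟩) hFrobl hxy hgen hx hx2

/-- **THE LOWER HALF ON THE EVEN TWO-PRIME CLASS from the named facts** (`tyz_cmPointRingClassFrobeniusValueData` opened by the typer's
`exists_cmPointRingClassFrobeniusFourPrintedH_of_value`).
[cite: TianYuanZhang2017, Thm. 1.1 and §3] [cite: Cox2013, §5.C Cor. 5.25, §9.A] [cite: Darmon2004, Thm. 3.22] -/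
theorem two_dvd_scriptL_two_primes_even_of_facts' (hV : tyz_cmPointRingClassFrobeniusValueData) (h11 : thm11_parity_of_scriptL)
    (hGZK : rank_eq_analyticRank_of_analyticRank_le_one)
    (hsq : Squarefree n) {l q : ℕ} (hl : l.Prime) (hq : q.Prime) (hlq : l ≠ q) (hn : n = 2 * l * q) (hl8 : l % 8 = 1) (hq4 : q % 4 = 3)
    (hleg : jacobiSym l q = 1)
    (hr : haveI := isElliptic_congruentNumberCurve hsq.ne_zero; (congruentNumberCurve n).analyticRank = 1)
    {x y : ℚ} (hxy : (congruentNumberCurve n).toAffine.Nonsingular x y)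
    (hgen : haveI := isElliptic_congruentNumberCurve hsq.ne_zero;
      ∀ P, ∃ k : ℤ, IsOfFinAddOrder (P - k • (Point.some x y hxy : (congruentNumberCurve n).toAffine.Point)))
    (hx : ¬ ∃ r : ℚ, x = r ^ 2 ∨ x = -r ^ 2 ∨ x = n * r ^ 2 ∨ x = -(n * r ^ 2))
    (hx2 : ¬ ∃ r : ℚ, x = 2 * r ^ 2 ∨ x = -(2 * r ^ 2) ∨ x = 2 * n * r ^ 2 ∨ x = -(2 * n * r ^ 2)) :
    ∀ L : ℤ, IsScriptL n L → (2 : ℤ) ∣ L := by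
  have h6 : n % 8 = 6 := by
    rw [hn, mul_assoc, Nat.mul_mod, show (l * q) % 8 = q % 8 by rw [Nat.mul_mod, hl8, one_mul, Nat.mod_mod]]; omega
  obtain ⟨D, hPr, hH⟩ := exists_cmPointRingClassFrobeniusFourPrintedH_of_value hV n hsq (Or.inr (Or.inl h6))
  exact two_dvd_scriptL_two_primes_even_of_printedH hGZK h11 hsq hl hq hlq hn hl8 hq4 hleg hr D hPr hH hxy hgen hx hx2

/-- **`OfFacts` shape for the planner** (by-name closable aside text of item 23431's even two-prime sector): the conjunction of the three named facts
implies — for every square-free `n = 2lq` with `l, q` prime, `l ≡ 1 (mod 8)`, `q ≡ 3 (mod 4)`, `(l/q) = 1`, `ord_{s=1} L(E_n, s) = 1`, and a generator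
`R = (x, y)` of `E_n(ℚ)` modulo torsion with `x ∉ {±1, ±2, ±n, ±2n}·ℚ^{×2}` — that `2 ∣ L` for every integer `L` with `𝓛(n)² = L²`.
[cite: TianYuanZhang2017, Thm. 1.1, §1 (p0002 L101–L110) and §3] [cite: Cox2013, §5.C Cor. 5.25, §9.A] [cite: HeathBrown1994SelmerCongruentII, §1] [cite: Darmon2004, Thm. 3.22] -/
theorem two_dvd_scriptL_two_primes_even_of_facts :
    (tyz_cmPointRingClassFrobeniusValueData ∧ thm11_parity_of_scriptL ∧ rank_eq_analyticRank_of_analyticRank_le_one) →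
      ∀ n l q : ℕ, (hsq : Squarefree n) → l.Prime → q.Prime → l ≠ q → n = 2 * l * q → l % 8 = 1 → q % 4 = 3 → jacobiSym l q = 1 →
        (haveI := isElliptic_congruentNumberCurve hsq.ne_zero; (congruentNumberCurve n).analyticRank = 1) →
        ∀ (x y : ℚ) (hxy : (congruentNumberCurve n).toAffine.Nonsingular x y),
          (haveI := isElliptic_congruentNumberCurve hsq.ne_zero;
            ∀ P, ∃ k : ℤ, IsOfFinAddOrder (P - k • (Point.some x y hxy : (congruentNumberCurve n).toAffine.Point))) →
          (¬ ∃ r : ℚ, x = r ^ 2 ∨ x = -r ^ 2 ∨ x = n * r ^ 2 ∨ x = -(n * r ^ 2)) →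
          (¬ ∃ r : ℚ, x = 2 * r ^ 2 ∨ x = -(2 * r ^ 2) ∨ x = 2 * n * r ^ 2 ∨ x = -(2 * n * r ^ 2)) →
            ∀ L : ℤ, IsScriptL n L → (2 : ℤ) ∣ L :=
  fun h _ _ _ hsq hl hq hlq hn hl8 hq4 hleg hr _ _ hxy hgen hx hx2 =>
    two_dvd_scriptL_two_primes_even_of_facts' h.1 h.2.1 h.2.2 hsq hl hq hlq hn hl8 hq4 hleg hr hxy hgen hx hx2

end Summit.BirchSwinnertonDyer.PrintCf2.LowerHalfTwoPrimesEvenFacts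

end
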